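import Summits.QuantumFields.YangMills.Theses.ParabolicTrajectory

open MeasureTheory Filter Topology
open Literature.MathematicalPhysics.QuantumFieldTheory Literature.MathematicalPhysics.QuantumLattice

noncomputable section

namespace Summit.QuantumFields.YangMills.Cruxes.LatticeGapOnTrajectory.Sketch

/-- The adapter `FixedBetaToTrajectory`, proved: a fixed-β clustering family with β-uniform
per-pair constants, the scaling floor `Δ₀ ≤ m(β_k) M^{n_k}` and the volume threshold
`S₁(β_k) ≤ L_k` gives `HasLatticeMassGap r sch Δ₀` along the M-adic sequence. -/
theorem fixedBetaToTrajectory_holds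
    (G : Type) [Group G] [TopologicalSpace G] [IsTopologicalGroup G] [CompactSpace G]
    [MeasurableSpace G] [BorelSpace G] (r : LatticeRep G) (M : ℕ)
    (sch : SpeciesScheme (YMSpecies G)) (n : ℕ → ℕ) (m : ℝ → ℝ) (S₁ : ℝ → ℕ) (β₁ Δ₀ : ℝ)
    (hΔ : 0 < Δ₀)
    (hfam : ∀ A B : YMSpecies G, ∃ C : ℝ, ∀ β : ℝ, β₁ ≤ β → ∀ S t : ℕ, S₁ β ≤ S → t ≤ S →
      |latticeConnectedCorr r.ρ β (2 * S + 1) A.F B.F t| ≤ C * Real.exp (-(m β * t)))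
    (hshape : ∀ k, sch.a k = ((M : ℝ) ^ n k)⁻¹)
    (hβ : Tendsto sch.β atTop atTop)
    (hfloor : ∀ᶠ k in atTop, Δ₀ ≤ m (sch.β k) * (M : ℝ) ^ n k)
    (hvol : ∀ᶠ k in atTop, S₁ (sch.β k) ≤ sch.L k) :
    HasLatticeMassGap r sch Δ₀ := by
  intro A B
  obtain ⟨C, hC⟩ := hfam A B
  refine ⟨C, ?_⟩
  have hβ₁ : ∀ᶠ k in atTop, β₁ ≤ sch.β k := hβ.eventually_ge_atTop β₁
  filter_upwards [hβ₁, hfloor, hvol] with k hk₁ hk₂ hk₃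
  intro S hS t ht
  have hSt : S₁ (sch.β k) ≤ S := hk₃.trans hS
  have h := hC (sch.β k) hk₁ S t hSt ht
  -- positivity of the spacing and the rate comparison Δ₀ a_k ≤ m(β_k)
  have ha : 0 < sch.a k := sch.a_pos k
  have hMpos : 0 < (M : ℝ) ^ n k := by
    have : ((M : ℝ) ^ n k)⁻¹ = sch.a k := (hshape k).symm
    have hinv : 0 < ((M : ℝ) ^ n k)⁻¹ := by rw [this]; exact ha
    exact inv_pos.mp hinv
  have hrate : Δ₀ * sch.a k ≤ m (sch.β k) := by
    rw [hshape k]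
    have := div_le_of_le_mul₀ hMpos.le (by
      have := hk₂; nlinarith [hΔ]) hk₂
    simpa [div_eq_mul_inv] using this
  have hC0 : 0 ≤ C := by
    have h0 : (0 : ℝ) ≤ C * Real.exp (-(m (sch.β k) * t)) := (abs_nonneg _).trans h
    have hexp : 0 < Real.exp (-(m (sch.β k) * t)) := Real.exp_pos _
    nlinarith
  calc |latticeConnectedCorr r.ρ (sch.β k) (2 * S + 1) A.F B.F t|
      ≤ C * Real.exp (-(m (sch.β k) * t)) := h
    _ ≤ C * Real.exp (-(Δ₀ * (sch.a k * t))) := by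
        refine mul_le_mul_of_nonneg_left ?_ hC0
        refine Real.exp_le_exp.2 ?_
        have ht0 : (0 : ℝ) ≤ t := Nat.cast_nonneg t
        have : Δ₀ * (sch.a k * t) ≤ m (sch.β k) * t := by
          calc Δ₀ * (sch.a k * t) = (Δ₀ * sch.a k) * t := by ring
            _ ≤ m (sch.β k) * t := mul_le_mul_of_nonneg_right hrate ht0
        linarith

end Summit.QuantumFields.YangMills.Cruxes.LatticeGapOnTrajectory.Sketch

end
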